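import Summits.Ventures.PercRepro.C025ProfileFourRuleE
import Summits.Ventures.PercRepro.C025ProfileRankFourLemmas
/-!
# THE ROW `q = 2` OF THE PROFILE INEQUALITY AT EVERY LEVEL `u` — the rule `E*_u` (night-3 g11)
`proofs/NIGHT3-G11-ESTAR.md`. ONE rule for every row `(2,u)`, `u ≥ 3`, of `(Π)` (C-032), symbolic in `u`, with no
fitted constant. For a rank-`2` set `B` with `p := ρ(E∖B) ≥ u` ("active") let `F_B := E ∖ cl B`,
`G_B := {Y ⊆ F_B : |Y| = u−2, ρ(B ∪ Y) = u}` (the good sets: `B ∪ Y` is an independent `u`-set), `N := |G_B|`,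
`P_B := {Z ⊆ F_B : |Z| = u−1, ρ(B ∪ Z) = u}`, `Ls_B := {{x} ∪ Y : x ∈ cl B ∖ B, Y ∈ G_B}`, and `d_B := price(B) =
C(p+2,u)/C(p+2,2) = C(p,u−2)/C(u,2)`. A PAIR `B` (`|B| = 2`) pays the EXACT generic share `g_B := min(1/C(u,2), d_B/N)`
on each good set; its deficit `D_B := d_B − N·g_B` is REQUESTED uniformly, `r_B := D_B/N` per good set; an independent
`u`-set `S` has the FREED capacity `φ(S) := 1 − Σ_{B′ ⊆ S active} g_{B′}` (the inactive pairs of `S` take nothing) and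
GRANTS the requests of its pairs scaled by `λ_S := min(1, φ(S)/Σ_{B′ ⊆ S} r_{B′})`; the RESIDUAL `D_B − Σ_{Y ∈ G_B} λ_{B∪Y} r_B`
is spread uniformly over `Ls_B` if the line of `B` has a third point, else over `P_B`. A FAT `B` (`|B| ≥ 3`) spreads
its price uniformly over `G_B ∪ P_B`. On every independent `u`-set the load is `≤ 1` BY CONSTRUCTION
(`cap_wEstar_of_card_eq`), and every rank-`2` set receives its price BY CONSTRUCTION (`dem_wEstar`, next module);
what is left for each `u` is `(Cap)` on the DEPENDENT rank-`u` sets. At `u = 4` with the residual in place of the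
deficit this is rule E of `C025ProfileFourRuleE` (whose `Pfam` is the parallel-pair sub-family); the exact checker
`work/lab/eu_star.py` reports 0 violations at `u = 3, 4, 5, 6, 7` on ≈ 20,000 simple matroids of ranks `4 … 10`.
This module: the definitions, non-negativity, the membership lemmas and the family-sum lemma; `(Cap)` on the
independent `u`-sets is `C025ProfileStarIndep`, `(Dem)` and the assembly follow.
-/
open scoped Matroid
namespace PercRepro
open Set Finset ThmH
namespace EStar
variable {α : Type} [DecidableEq α] (M : Matroid α) [M.Finite] (u : ℕ)

/-- `cap u = 1/C(u,2)`: the share of one pair of an independent `u`-set. -/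
noncomputable def cap : ℚ := 1 / (Nat.choose u 2 : ℚ)

open scoped Classical in
/-- `G_B`: the `(u−2)`-subsets of `F_B` independent in `M／B`. -/
noncomputable def Gfam (B : Finset α) : Finset (Finset α) :=
  ((Fs M B).powersetCard (u - 2)).filter (fun Y => M.eRk ((B ∪ Y : Finset α) : Set α) = (u : ℕ∞))

open scoped Classical in
/-- `P_B`: the `(u−1)`-subsets `Z` of `F_B` with `ρ(B ∪ Z) = u`. -/
noncomputable def Pfam (B : Finset α) : Finset (Finset α) :=
  ((Fs M B).powersetCard (u - 1)).filter (fun Z => M.eRk ((B ∪ Z : Finset α) : Set α) = (u : ℕ∞))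

/-- `Ls_B`: `{x} ∪ Y` with `x` a point of the line of `B` outside `B` and `Y ∈ G_B`. -/
noncomputable def Lfam (B : Finset α) : Finset (Finset α) :=
  ((clF M B \ B) ×ˢ Gfam M u B).image (fun xY => insert xY.1 xY.2)

/-- The exact generic share `g_B = min(1/C(u,2), price/|G_B|)`. -/
noncomputable def gsh (B : Finset α) : ℚ :=
  min (cap u) (Profile.price M 2 u B / ((Gfam M u B).card : ℚ))

/-- The deficit `D_B = price − |G_B|·g_B`. -/
noncomputable def defic (B : Finset α) : ℚ :=
  Profile.price M 2 u B - ((Gfam M u B).card : ℚ) * gsh M u B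

/-- The request `r_B = D_B/|G_B|` of `B` on each of its good sets. -/
noncomputable def req (B : Finset α) : ℚ := defic M u B / ((Gfam M u B).card : ℚ)

open scoped Classical in
/-- The active pairs of `S`: its `2`-subsets of complement rank `≥ u`. -/
noncomputable def actPairs (S : Finset α) : Finset (Finset α) :=
  (S.powersetCard 2).filter (fun B => u ≤ crk M B)

/-- The freed capacity `φ(S) = 1 − Σ_{B ⊆ S active} g_B`. -/
noncomputable def freed (S : Finset α) : ℚ := 1 - ∑ B ∈ actPairs M u S, gsh M u B

/-- The total request `Σ_{B ⊆ S active} r_B` of the pairs of `S`. -/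
noncomputable def reqsum (S : Finset α) : ℚ := ∑ B ∈ actPairs M u S, req M u B

open scoped Classical in
/-- The grant factor `λ_S = min(1, φ(S)/Σ r)` of `S` (as `max 0 (…)` outside the trivial case, so that `0 ≤ λ_S ≤ 1`). -/
noncomputable def grant (S : Finset α) : ℚ :=
  if reqsum M u S ≤ freed M u S then 1 else max 0 (freed M u S / reqsum M u S)

/-- What `B` receives from the grants of its good sets. -/
noncomputable def recv (B : Finset α) : ℚ := ∑ Y ∈ Gfam M u B, req M u B * grant M u (B ∪ Y)

/-- The residual deficit `D_B − recv(B)`. -/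
noncomputable def resid (B : Finset α) : ℚ := defic M u B - recv M u B

open scoped Classical in
/-- **Rule `E*_u`** (capacity-`1` normalisation). -/
noncomputable def wEstar (B S : Finset α) : ℚ :=
  if crk M B < u then 0
  else if B.card = 2 then
    (if S \ B ∈ Gfam M u B then gsh M u B + req M u B * grant M u S else 0) +
    (if 1 ≤ (clF M B \ B).card then
      (if S \ B ∈ Lfam M u B then resid M u B / ((Lfam M u B).card : ℚ) else 0)
     else (if S \ B ∈ Pfam M u B then resid M u B / ((Pfam M u B).card : ℚ) else 0))
  else if S \ B ∈ Gfam M u B ∪ Pfam M u B then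
    Profile.price M 2 u B / ((Gfam M u B ∪ Pfam M u B).card : ℚ)
  else 0

variable {M u}

/-! ## Non-negativity -/

/-- `cap u ≥ 0`. -/
theorem cap_nonneg : 0 ≤ cap u := by unfold cap; positivity

/-- `cap u > 0` for `u ≥ 2`. -/
theorem cap_pos (hu : 2 ≤ u) : 0 < cap u := by
  unfold cap
  have : 0 < Nat.choose u 2 := Nat.choose_pos hu
  positivity

/-- `g_B ≥ 0`. -/
theorem gsh_nonneg (B : Finset α) : 0 ≤ gsh M u B := by
  unfold gsh
  exact le_min cap_nonneg (div_nonneg (Profile.price_nonneg 2 u B) (Nat.cast_nonneg _))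

/-- `g_B ≤ cap u`. -/
theorem gsh_le_cap (B : Finset α) : gsh M u B ≤ cap u := min_le_left _ _

/-- `|G_B| · g_B ≤ price(B)`. -/
theorem card_mul_gsh_le_price (B : Finset α) :
    ((Gfam M u B).card : ℚ) * gsh M u B ≤ Profile.price M 2 u B := by
  by_cases h0 : (Gfam M u B).card = 0
  · rw [h0, Nat.cast_zero, zero_mul]; exact Profile.price_nonneg 2 u B
  · have hc : (0 : ℚ) < ((Gfam M u B).card : ℚ) := by exact_mod_cast Nat.pos_of_ne_zero h0
    have h1 : gsh M u B ≤ Profile.price M 2 u B / ((Gfam M u B).card : ℚ) := min_le_right _ _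
    calc ((Gfam M u B).card : ℚ) * gsh M u B
        ≤ ((Gfam M u B).card : ℚ) * (Profile.price M 2 u B / ((Gfam M u B).card : ℚ)) :=
          mul_le_mul_of_nonneg_left h1 hc.le
      _ = Profile.price M 2 u B := by field_simp

/-- `D_B ≥ 0`. -/
theorem defic_nonneg (B : Finset α) : 0 ≤ defic M u B := by
  unfold defic; linarith [card_mul_gsh_le_price (M := M) (u := u) B]

/-- `r_B ≥ 0`. -/
theorem req_nonneg (B : Finset α) : 0 ≤ req M u B :=
  div_nonneg (defic_nonneg B) (Nat.cast_nonneg _)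

/-- `Σ r ≥ 0`. -/
theorem reqsum_nonneg (S : Finset α) : 0 ≤ reqsum M u S :=
  Finset.sum_nonneg (fun B _ => req_nonneg B)

/-- `0 ≤ λ_S`. -/
theorem grant_nonneg (S : Finset α) : 0 ≤ grant M u S := by
  unfold grant
  split_ifs
  · exact zero_le_one
  · exact le_max_left _ _

/-- `λ_S ≤ 1`. -/
theorem grant_le_one (S : Finset α) : grant M u S ≤ 1 := by
  unfold grant
  split_ifs with h
  · exact le_rfl
  · push Not at h
    apply max_le zero_le_one
    have hr := reqsum_nonneg (M := M) (u := u) S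
    rcases hr.lt_or_eq with hr | hr
    · rw [div_le_one hr]; exact h.le
    · rw [← hr, div_zero]; exact zero_le_one

/-- `recv(B) ≤ D_B`. -/
theorem recv_le_defic (B : Finset α) : recv M u B ≤ defic M u B := by
  unfold recv
  calc ∑ Y ∈ Gfam M u B, req M u B * grant M u (B ∪ Y)
      ≤ ∑ _Y ∈ Gfam M u B, req M u B := by
        apply Finset.sum_le_sum
        intro Y _
        calc req M u B * grant M u (B ∪ Y) ≤ req M u B * 1 :=
              mul_le_mul_of_nonneg_left (grant_le_one _) (req_nonneg B)
          _ = req M u B := mul_one _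
    _ = ((Gfam M u B).card : ℚ) * req M u B := by rw [Finset.sum_const, nsmul_eq_mul]
    _ ≤ defic M u B := by
        unfold req
        by_cases h0 : (Gfam M u B).card = 0
        · rw [h0, Nat.cast_zero, zero_mul]; exact defic_nonneg B
        · have hc : ((Gfam M u B).card : ℚ) ≠ 0 := by exact_mod_cast h0
          rw [mul_div_cancel₀ _ hc]

/-- The residual is non-negative. -/
theorem resid_nonneg (B : Finset α) : 0 ≤ resid M u B := by
  unfold resid; linarith [recv_le_defic (M := M) (u := u) B]

/-- Rule `E*_u` is non-negative. -/
theorem wEstar_nonneg (B S : Finset α) : 0 ≤ wEstar M u B S := by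
  unfold wEstar
  have hp := Profile.price_nonneg (M := M) 2 u B
  have hg := gsh_nonneg (M := M) (u := u) B
  have hr := req_nonneg (M := M) (u := u) B
  have hl := grant_nonneg (M := M) (u := u) S
  have hd := resid_nonneg (M := M) (u := u) B
  split_ifs <;> first | exact le_rfl | positivity

/-! ## Membership and cardinalities of the three families -/

/-- Membership in `G_B`. -/
theorem mem_Gfam {B Y : Finset α} :
    Y ∈ Gfam M u B ↔ Y ⊆ Fs M B ∧ Y.card = u - 2 ∧ M.eRk ((B ∪ Y : Finset α) : Set α) = (u : ℕ∞) := by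
  unfold Gfam
  rw [Finset.mem_filter, Finset.mem_powersetCard]
  tauto

/-- Membership in `P_B`. -/
theorem mem_Pfam {B Z : Finset α} :
    Z ∈ Pfam M u B ↔ Z ⊆ Fs M B ∧ Z.card = u - 1 ∧ M.eRk ((B ∪ Z : Finset α) : Set α) = (u : ℕ∞) := by
  unfold Pfam
  rw [Finset.mem_filter, Finset.mem_powersetCard]
  tauto

/-- Membership in `Ls_B`. -/
theorem mem_Lfam {B Z : Finset α} :
    Z ∈ Lfam M u B ↔ ∃ x ∈ clF M B \ B, ∃ Y ∈ Gfam M u B, insert x Y = Z := by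
  unfold Lfam
  rw [Finset.mem_image]
  constructor
  · rintro ⟨⟨x, Y⟩, hxY, rfl⟩
    rw [Finset.mem_product] at hxY
    exact ⟨x, hxY.1, Y, hxY.2, rfl⟩
  · rintro ⟨x, hx, Y, hY, rfl⟩
    exact ⟨⟨x, Y⟩, Finset.mem_product.2 ⟨hx, hY⟩, rfl⟩

/-- A point of the line of `B` is not in a subset of `F_B`. -/
theorem notMem_of_mem_clF_of_subset_Fs {B Y : Finset α} {x : α} (hx : x ∈ clF M B) (hY : Y ⊆ Fs M B) :
    x ∉ Y := fun hxY => (mem_Fs.1 (hY hxY)).2 hx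

/-- The sets of `Ls_B` have `u − 1` points. -/
theorem card_of_mem_Lfam {B Z : Finset α} (hZ : Z ∈ Lfam M u B) : Z.card = u - 2 + 1 := by
  obtain ⟨x, hx, Y, hY, rfl⟩ := mem_Lfam.1 hZ
  have hYm := mem_Gfam.1 hY
  rw [Finset.mem_sdiff] at hx
  rw [Finset.card_insert_of_notMem (notMem_of_mem_clF_of_subset_Fs hx.1 hYm.1), hYm.2.1]

/-- A good set is disjoint from `B` and `B ∪ Y` is a rank-`u` subset of the ground set. -/
theorem disjoint_and_level_of_mem_Gfam {B Y : Finset α} (hBg : B ⊆ gr M) (hY : Y ∈ Gfam M u B) :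
    Disjoint B Y ∧ B ∪ Y ∈ Shadow.levelSet M u := by
  rw [mem_Gfam] at hY
  refine ⟨disjoint_of_subset_Fs hBg hY.1, Profile.mem_levelSet.2 ⟨?_, hY.2.2⟩⟩
  exact Finset.union_subset hBg (hY.1.trans (Fs_subset_gr B))

/-- A set of `P_B` is disjoint from `B` and `B ∪ Z` is a rank-`u` subset of the ground set. -/
theorem disjoint_and_level_of_mem_Pfam {B Z : Finset α} (hBg : B ⊆ gr M) (hZ : Z ∈ Pfam M u B) :
    Disjoint B Z ∧ B ∪ Z ∈ Shadow.levelSet M u := by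
  rw [mem_Pfam] at hZ
  refine ⟨disjoint_of_subset_Fs hBg hZ.1, Profile.mem_levelSet.2 ⟨?_, hZ.2.2⟩⟩
  exact Finset.union_subset hBg (hZ.1.trans (Fs_subset_gr B))

/-- Inserting a point of `cl X` into `X` does not change the rank. -/
theorem eRk_insert_eq_of_mem_closure {X : Finset α} (hX : X ⊆ gr M) {x : α}
    (hx : x ∈ M.closure (X : Set α)) : M.eRk ((insert x X : Finset α) : Set α) = M.eRk (X : Set α) := by
  apply le_antisymm
  · rw [← M.eRk_closure_eq (X : Set α)]
    apply M.eRk_mono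
    intro y hy
    rw [Finset.coe_insert, Set.mem_insert_iff] at hy
    rcases hy with rfl | hy
    · exact hx
    · exact M.subset_closure _ (by rw [← coe_gr]; exact_mod_cast hX) hy
  · apply M.eRk_mono
    rw [Finset.coe_insert]; exact Set.subset_insert _ _

/-- A set of `Ls_B` is disjoint from `B` and `B ∪ Z` is a rank-`u` subset of the ground set. -/
theorem disjoint_and_level_of_mem_Lfam {B Z : Finset α} (hBg : B ⊆ gr M) (hZ : Z ∈ Lfam M u B) :
    Disjoint B Z ∧ B ∪ Z ∈ Shadow.levelSet M u := by
  obtain ⟨x, hx, Y, hY, rfl⟩ := mem_Lfam.1 hZ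
  have hYm := mem_Gfam.1 hY
  rw [Finset.mem_sdiff] at hx
  have hdisj : Disjoint B (insert x Y) := by
    rw [Finset.disjoint_insert_right]
    exact ⟨hx.2, disjoint_of_subset_Fs hBg hYm.1⟩
  have hBYg : B ∪ Y ⊆ gr M := Finset.union_subset hBg (hYm.1.trans (Fs_subset_gr B))
  refine ⟨hdisj, Profile.mem_levelSet.2 ⟨?_, ?_⟩⟩
  · exact Finset.union_subset hBg (Finset.insert_subset (clF_subset_gr B hx.1) (hYm.1.trans (Fs_subset_gr B)))
  · have hucl : x ∈ M.closure ((B ∪ Y : Finset α) : Set α) := by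
      have h1 : x ∈ M.closure (B : Set α) := by rw [← coe_clF]; exact_mod_cast hx.1
      exact M.closure_subset_closure (by rw [Finset.coe_union]; exact Set.subset_union_left) h1
    have heq : B ∪ insert x Y = insert x (B ∪ Y) := by
      ext y; simp only [Finset.mem_union, Finset.mem_insert]; tauto
    rw [heq, eRk_insert_eq_of_mem_closure hBYg hucl, hYm.2.2]

/-- The sum of a non-negative function over the rank-`u` supersets of `B` dominates its sum over `B ∪ Z`, `Z` in a
family of sets disjoint from `B` with `B ∪ Z` of rank `u`. -/
theorem sum_levelSet_ge_sum_family {B : Finset α} (f : Finset α → ℚ) (hf : ∀ S, 0 ≤ f S)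
    (fam : Finset (Finset α)) (hfam : ∀ Z ∈ fam, Disjoint B Z ∧ B ∪ Z ∈ Shadow.levelSet M u) :
    ∑ Z ∈ fam, f (B ∪ Z) ≤ ∑ S ∈ (Shadow.levelSet M u).filter (fun S => B ⊆ S), f S := by
  have hinj : Set.InjOn (fun Z => B ∪ Z) (fam : Set (Finset α)) := by
    intro Z hZ Z' hZ' h
    have h1 := union_sdiff_self_eq (hfam Z hZ).1
    have h2 := union_sdiff_self_eq (hfam Z' hZ').1
    simp only at h
    rw [← h1, ← h2, h]
  rw [← Finset.sum_image hinj]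
  apply Finset.sum_le_sum_of_subset_of_nonneg
  · intro S hS
    rw [Finset.mem_image] at hS
    obtain ⟨Z, hZ, rfl⟩ := hS
    exact Finset.mem_filter.2 ⟨(hfam Z hZ).2, Finset.subset_union_left⟩
  · intro S _ _
    exact hf S

end EStar
end PercRepro
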